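import Summits.BirchSwinnertonDyer.Rank1Residual.X11b.AnticyclotomicGoodPlaces
import Summits.BirchSwinnertonDyer.BirchSwinnertonDyer.Theorems.UniversalToricDescentResidualSelmerFinite
import HarnessLib

/-!
# Route UniversalToricDescent — the local lemma (H) of the residual Selmer comparison, PROVED: at a good
# `v ∤ p`, for any `H ⊇ I_v` (e.g. `Gal(K̄/K_∞)` of any `ℤ_p`-extension), a class of `H¹(H, E[p])` unramified
# at the chosen place above `v` becomes locally trivial in `H¹(H, E[p^∞])` («`H¹_ur(K_{∞,w}, E[p^∞]) = 0`»)

Lead prover bsd-wall-utd-p1 g6 (`--supports stmt-BirchSwinnertonDyer-20399`; discharges the hypothesis `hH`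
of `UniversalToricDescentResidualSelmerComparison`). §1: `H¹(Ω ⊓ D_v, E[p^∞]) ↪ H¹(I_v, E[p^∞])` for
every OPEN `Ω ⊇ I_v` (`Ω ⊓ D_v` is generated by `I_v`, any small open subgroup and the least Frobenius
power `φ^m ∈ Ω`; `φ^m − 1` is onto `E[p^∞]`; the tree's `resOfLe_injective_of_frobenius_generation`,
which at the base is Greenberg's Lemma 3.3 `X11b/AnticyclotomicGoodPlaces`). §2: a continuous cocycle with
finite coefficients on ANY subgroup `H ≤ Γ_K` extends to an open `Ω ⊇ H` (uniform local constancy; Serre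
I §2.2 Prop. 8). §3: (H), uniformly in the decomposition behaviour of `v` in `K_∞`. The companion
`UniversalToricDescentResidualSelmerTransfer` draws the unconditional residual Selmer comparison.
THEOREMS ONLY; no definition, no named fact, no `sorry`. BSD is not advanced by this file.
References: [GreenbergLNM1716] §3 Lemma 3.3 (p. 87); [GreenbergVatsal2000] §2 p. 17, p. 26;
[SerreGaloisCohomology1997] I §2.2 Prop. 8, I §2.6, I §5.1; [SerreLocalFields1979] XIII §1; [NeukirchANT1999] I §9 (9.4).
-/

set_option autoImplicit false
-- `…BirchSwinnertonDyer.BirchSwinnertonDyer.Theorems…` is the problem's mandated namespace (D-0017).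
set_option linter.dupNamespace false
noncomputable section
open scoped Classical Topology
namespace Summit.BirchSwinnertonDyer.BirchSwinnertonDyer.Theorems.UniversalToricDescentResidualSelmerLocal

open NumberField IsDedekindDomain Field
open Literature.NumberTheory.EllipticCurves Literature.NumberTheory.EllipticCurves.GreenbergSelmer
  Literature.NumberTheory.EllipticCurves.GreenbergVatsal2000
  Literature.NumberTheory.EllipticCurves.FineSelmerCoefficientMap
  Literature.NumberTheory.GaloisRepresentations IsDedekindDomain.HeightOneSpectrum WeierstrassCurve
  Summit.BirchSwinnertonDyer.Rank1Residual.X11b Summit.BirchSwinnertonDyer.Rank1Residual.X11b.AcSelmer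

/-! ### §1 `H¹(Ω ⊓ D_v, E[p^∞]) ↪ H¹(I_v, E[p^∞])` for every open `Ω ⊇ I_v`, at a good `v ∤ p` -/

section OpenLevel

variable {K : Type} [Field K] [NumberField K] (E : WeierstrassCurve K) [E.IsElliptic]
  (p : ℕ) [Fact p.Prime]

/-- **At a good `v ∤ p`, `φ^m − 1` is onto `E[p^∞]` for every arithmetic Frobenius `φ` at every `𝔓 ∣ v`
and every `m > 0`.** The tree's `exists_mem_geomPrimaryTorsion_frobenius_pow_sub_eq` (local Frobenius
`σ₀` along the chosen embedding, any positive power) transported to `𝔓` by `τ • 𝔓₀ = 𝔓` and to `φ` by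
`φ γ⁻¹ ∈ I_𝔓` (so `φ^m` acts on `E[p^∞]` as `γ^m`, inertia acting trivially, Silverman VII.4.1(a)).
[cite: GreenbergLNM1716, §3 Lemma 3.3 (p. 87), good case] [cite: SilvermanAEC2009, Prop. VII.4.1] -/
theorem exists_frob_pow_smul_sub_eq {v : HeightOneSpectrum (𝓞 K)}
    (hpv : (p : 𝓞 K) ∉ v.asIdeal) (hv : E.HasGoodReductionAt v)
    {𝔓 : Ideal (absIntegers (𝓞 K) K)} (h𝔓 : 𝔓 ∈ v.primesAbove)
    {φ : absoluteGaloisGroup K} (hφ : IsArithFrobAt (𝓞 K) φ 𝔓) {m : ℕ} (hm : 0 < m)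
    (x : E.geomPrimaryTorsion p) :
    ∃ b : E.geomPrimaryTorsion p, φ ^ m • b - b = x := by
  obtain ⟨𝔐, h𝔐⟩ := v.localPrimesAbove_nonempty
  set ι := closureEmb (K := K) (v.adicCompletion K) with hι
  obtain ⟨σL, hσL⟩ := v.exists_isArithFrobAt_localAbsIntegers h𝔐
  set σ₀ : absoluteGaloisGroup K := resGalOfEmb ι σL with hσ₀
  have h𝔓₁ : v.primeBelow ι 𝔐 ∈ v.primesAbove := primeBelow_mem_primesAbove h𝔐
  have hσ₀F : IsArithFrobAt (𝓞 K) σ₀ (v.primeBelow ι 𝔐) :=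
    WeierstrassCurve.isArithFrobAt_resGalOfEmb h𝔐 ι hσL
  obtain ⟨τ, hτ⟩ := exists_smul_eq_of_mem_primesAbove_holds h𝔓₁ h𝔓
  set γ : absoluteGaloisGroup K := τ * σ₀ * τ⁻¹ with hγ
  have hγF : IsArithFrobAt (𝓞 K) γ 𝔓 := hτ ▸ hσ₀F.conj τ
  have hIn : φ * γ⁻¹ ∈ 𝔓.inertia (absoluteGaloisGroup K) := hφ.mul_inv_mem_inertia hγF
  have hφγ : ∀ (n : ℕ) (b : E.geomPrimaryTorsion p), φ ^ n • b = γ ^ n • b := by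
    intro n
    induction n with
    | zero => intro b; rw [pow_zero, pow_zero]
    | succ n ih =>
      intro b
      rw [pow_succ', mul_smul, ih, pow_succ', mul_smul]
      conv_lhs => rw [← inv_mul_cancel_right φ γ, mul_smul]
      rw [smul_geomPrimaryTorsion_eq_of_mem_inertia E p hpv hv h𝔓 hIn]
  have hγm : ∀ n : ℕ, γ ^ n = τ * σ₀ ^ n * τ⁻¹ := by
    intro n
    induction n with
    | zero => rw [pow_zero, pow_zero, mul_one, mul_inv_cancel]
    | succ n ih => rw [pow_succ, ih, hγ, pow_succ]; group
  obtain ⟨z, hz, hzeq⟩ := exists_mem_geomPrimaryTorsion_frobenius_pow_sub_eq E hpv hv h𝔐 ι hσL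
    hm (a := ((τ⁻¹ • x : E.geomPrimaryTorsion p) : E.geomPoints)) (τ⁻¹ • x).2
  refine ⟨τ • ⟨z, hz⟩, ?_⟩
  rw [hφγ, hγm m]
  apply Subtype.ext
  have h1 : (((τ * σ₀ ^ m * τ⁻¹) • (τ • (⟨z, hz⟩ : E.geomPrimaryTorsion p)) -
      τ • (⟨z, hz⟩ : E.geomPrimaryTorsion p) : E.geomPrimaryTorsion p) : E.geomPoints) =
      τ • (σ₀ ^ m • z - z) := by
    rw [AddSubgroupClass.coe_sub, primaryComponent.coe_smul, primaryComponent.coe_smul, smul_sub,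
      ← mul_smul, ← mul_smul, inv_mul_cancel_right, mul_smul]
  rw [h1, hzeq, primaryComponent.coe_smul, ← mul_smul, mul_inv_cancel, one_smul]

/-- **`H¹(Ω ⊓ D_v, E[p^∞]) ↪ H¹(I_v, E[p^∞])` for every OPEN subgroup `Ω ⊇ I_v` of `Γ_K`** at a finite
place `v ∤ p` of good reduction (`D_v ⊇ I_v` the decomposition and inertia groups of the prime
`𝔓₀ = adicCompletionPrime K v` of the chosen embedding). With `φ` an arithmetic Frobenius at `𝔓₀` and `m`
the least positive integer with `φ^m ∈ Ω` (`Ω` has finite index), every element of `Ω ⊓ D_v` is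
`(φ^m)^k · i · u` with `i ∈ I_v` and `u` in any prescribed open subgroup (`D_v = ⟨φ⟩·I_v·U`, tree
`exists_eq_frobenius_pow_mul_of_mem_decompositionSubgroup`, and `φ^j ∈ Ω ⟹ m ∣ j`); `I_v` acts trivially
and `φ^m − 1` is onto `E[p^∞]`; so the tree's `resOfLe_injective_of_frobenius_generation` applies. For
`Ω = Gal(K̄/K_n)` a layer of a `ℤ_p`-extension this is Greenberg–Vatsal's "`G_η/I_η` has profinite order
prime to `p`, so `[σ|G_η] = 0 ⟺ [σ|I_η] = 0`" one level up. [cite: GreenbergLNM1716, §3 Lemma 3.3 (p. 87)]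
[cite: GreenbergVatsal2000, §2 p. 17] -/
theorem resOfLe_inertia_injective_of_isOpen {v : HeightOneSpectrum (𝓞 K)}
    (hpv : (p : 𝓞 K) ∉ v.asIdeal) (hv : E.HasGoodReductionAt v)
    {Ω : Subgroup (absoluteGaloisGroup K)} (hΩ : IsOpen (Ω : Set (absoluteGaloisGroup K)))
    (hIΩ : (adicCompletionPrime K v).inertia (absoluteGaloisGroup K) ≤ Ω) :
    Function.Injective (resOfLe (E.geomPrimaryTorsion p)
      (le_inf hIΩ (inertia_adicCompletionPrime_le_decomp v) :
        (adicCompletionPrime K v).inertia (absoluteGaloisGroup K) ≤ Ω ⊓ decomp v)) := by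
  have h𝔓₀ := adicCompletionPrime_mem_primesAbove K v
  haveI : (adicCompletionPrime K v).IsPrime := h𝔓₀.1
  have e : decomp v = (adicCompletionPrime K v).decompositionSubgroup (absoluteGaloisGroup K) := by
    rw [decompositionSubgroup_adicCompletionPrime_eq_range]; rfl
  obtain ⟨φ, hφ⟩ := exists_isArithFrobAt_of_mem_primesAbove_holds h𝔓₀
  have hφD : φ ∈ decomp v := by rw [e]; exact hφ.mem_stabilizer
  haveI : Finite (absoluteGaloisGroup K ⧸ Ω) := Subgroup.quotient_finite_of_isOpen Ω hΩ
  have hex : ∃ n : ℕ, 0 < n ∧ φ ^ n ∈ Ω := by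
    obtain ⟨n, hn, -, hmem⟩ := Subgroup.exists_pow_mem_of_index_ne_zero
      (Subgroup.index_ne_zero_of_finite (H := Ω)) φ
    exact ⟨n, hn, hmem⟩
  set m := Nat.find hex with hmdef
  have hm : 0 < m ∧ φ ^ m ∈ Ω := Nat.find_spec hex
  have hmin : ∀ j : ℕ, φ ^ j ∈ Ω → m ∣ j := by
    intro j hj
    have hr : φ ^ (j % m) ∈ Ω := by
      have hdecomp : φ ^ j = (φ ^ m) ^ (j / m) * φ ^ (j % m) := by
        rw [← pow_mul, ← pow_add, Nat.div_add_mod]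
      have : φ ^ (j % m) = ((φ ^ m) ^ (j / m))⁻¹ * φ ^ j := by
        rw [hdecomp, inv_mul_cancel_left]
      rw [this]
      exact Ω.mul_mem (Ω.inv_mem (Ω.pow_mem hm.2 _)) hj
    by_contra hndvd
    have hpos : 0 < j % m := Nat.pos_of_ne_zero (fun h ↦ hndvd (Nat.dvd_of_mod_eq_zero h))
    have hlt : j % m < m := Nat.mod_lt j hm.1
    exact (Nat.find_min hex hlt) ⟨hpos, hr⟩
  have hφmD : φ ^ m ∈ Ω ⊓ decomp v := Subgroup.mem_inf.mpr ⟨hm.2, (decomp v).pow_mem hφD m⟩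
  refine resOfLe_injective_of_frobenius_generation
    (le_inf hIΩ (inertia_adicCompletionPrime_le_decomp v)) hφmD (fun U hU d hd ↦ ?_)
    (E.continuous_smul_geomPrimaryTorsion p)
    (fun i hi x ↦ smul_geomPrimaryTorsion_eq_of_mem_inertia E p hpv hv h𝔓₀ hi x)
    (exists_frob_pow_smul_sub_eq E p hpv hv h𝔓₀ hφ hm.1)
  have hdD : d ∈ (adicCompletionPrime K v).decompositionSubgroup (absoluteGaloisGroup K) := by
    rw [← e]; exact (Subgroup.mem_inf.mp hd).2
  obtain ⟨j, i, u, hi, hu, hdeq⟩ := exists_eq_frobenius_pow_mul_of_mem_decompositionSubgroup h𝔓₀ hφ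
    (U := U ⊓ Ω) (hU.inter hΩ) hdD
  have huU : u ∈ U := (Subgroup.mem_inf.mp hu).1
  have huΩ : u ∈ Ω := (Subgroup.mem_inf.mp hu).2
  have hφj : φ ^ j ∈ Ω := by
    have : φ ^ j = d * u⁻¹ * i⁻¹ := by rw [hdeq]; group
    rw [this]
    exact Ω.mul_mem (Ω.mul_mem (Subgroup.mem_inf.mp hd).1 (Ω.inv_mem huΩ)) (Ω.inv_mem (hIΩ hi))
  obtain ⟨k, hk⟩ := hmin j hφj
  exact ⟨k, i, u, hi, huU, by rw [← pow_mul, ← hk]; exact hdeq⟩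

end OpenLevel

/-! ### §2 A continuous cocycle with finite coefficients on a subgroup `H ≤ Γ_K` extends to an OPEN
subgroup `Ω ⊇ H` -/

section Extension

variable {K : Type} [Field K] [NumberField K]
variable {M : Type} [AddCommGroup M] [DistribMulAction (absoluteGaloisGroup K) M]
  [TopologicalSpace M] [DiscreteTopology M]

/-- **Extension of cocycles to an open subgroup.** Let `M` be a FINITE discrete `Γ_K`-module with
continuous orbit maps and `H ≤ Γ_K` any subgroup. Every class `y ∈ H¹(H, M)` is the restriction of a
class of `H¹(Ω, M)` for some OPEN subgroup `Ω ⊇ H`. (A cocycle `z` of `y` vanishes on `H ∩ W` and `W`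
acts trivially on `M` for some open normal `W ⊴ Γ_K` — the kernel of the action is open, the zero set of
`z` is a neighbourhood of `1`, and `Γ_K` is profinite; on `Ω = H·W` put `z̃(h w) = z(h)`, well defined
because `z(h⁻¹h') = 0` for `h⁻¹ h' ∈ W`, a cocycle because `W ⊴ Γ_K` fixes `M`, locally constant.) This is
the surjectivity half of `H¹(⋂ Ωᵢ, M) = lim→ H¹(Ωᵢ, M)` (Serre I §2.2 Prop. 8) for `H = ⋂ {open Ω ⊇ H}`.
[cite: SerreGaloisCohomology1997, I §2.2 Prop. 8] -/
theorem exists_isOpen_resOfLe_eq [Finite M]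
    (hcont : ∀ m : M, Continuous fun g : absoluteGaloisGroup K ↦ g • m)
    (H : Subgroup (absoluteGaloisGroup K))
    (y : Literature.NumberTheory.EllipticCurves.subgroupH1 H M) :
    ∃ Ω : Subgroup (absoluteGaloisGroup K), IsOpen (Ω : Set (absoluteGaloisGroup K)) ∧
      ∃ hle : H ≤ Ω, ∃ z : Literature.NumberTheory.EllipticCurves.subgroupH1 Ω M,
        resOfLe M hle z = y := by
  classical
  haveI : CompactSpace (absoluteGaloisGroup K) := by
    change CompactSpace (AlgebraicClosure K ≃ₐ[K] AlgebraicClosure K); infer_instance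
  haveI : TotallyDisconnectedSpace (absoluteGaloisGroup K) := by
    change TotallyDisconnectedSpace (AlgebraicClosure K ≃ₐ[K] AlgebraicClosure K); infer_instance
  obtain ⟨z, rfl⟩ := oneCocycleClass_surjective _ y
  have hstab : ∀ m : M, IsOpen {g : absoluteGaloisGroup K | g • m = m} := fun m ↦ by
    have h : IsOpen ((fun g : absoluteGaloisGroup K ↦ g • m) ⁻¹' {m}) :=
      (isOpen_discrete ({m} : Set M)).preimage (hcont m)
    exact h
  have hU₁ : IsOpen (⋂ m : M, {g : absoluteGaloisGroup K | g • m = m}) :=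
    isOpen_iInter_of_finite hstab
  have hzero : IsOpen ((fun x : H ↦ z.1 x) ⁻¹' {0}) :=
    (isOpen_discrete ({0} : Set M)).preimage z.1.continuous
  obtain ⟨V, hV, hVeq⟩ := isOpen_induced_iff.mp hzero
  have h1V : (1 : absoluteGaloisGroup K) ∈ V := by
    have h1 : (1 : H) ∈ (fun x : H ↦ z.1 x) ⁻¹' {0} := contOneCocycles.apply_one z
    rw [← hVeq] at h1
    exact h1
  have hVz : ∀ (g : absoluteGaloisGroup K) (hg : g ∈ H), g ∈ V → z.1 ⟨g, hg⟩ = 0 := by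
    intro g hg hgV
    have h : (⟨g, hg⟩ : H) ∈ Subtype.val ⁻¹' V := hgV
    rw [hVeq] at h
    exact h
  have h1 : (1 : absoluteGaloisGroup K) ∈ (⋂ m : M, {g : absoluteGaloisGroup K | g • m = m}) ∩ V :=
    ⟨Set.mem_iInter.mpr fun m ↦ one_smul _ m, h1V⟩
  obtain ⟨W, hW⟩ := ProfiniteGrp.exist_openNormalSubgroup_sub_open_nhds_of_one (hU₁.inter hV) h1
  have hWfix : ∀ w ∈ (W : Subgroup (absoluteGaloisGroup K)), ∀ m : M, w • m = m := fun w hw m ↦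
    Set.mem_iInter.mp (hW hw).1 m
  have hWz : ∀ (g : absoluteGaloisGroup K) (hg : g ∈ H), g ∈ (W : Subgroup (absoluteGaloisGroup K)) →
      z.1 ⟨g, hg⟩ = 0 := fun g hg hgW ↦ hVz g hg (hW hgW).2
  set N : Subgroup (absoluteGaloisGroup K) := W.toSubgroup with hN
  have hNopen : IsOpen (N : Set (absoluteGaloisGroup K)) := W.toOpenSubgroup.isOpen
  have hNfix : ∀ w ∈ N, ∀ m : M, w • m = m := fun w hw m ↦ hWfix w hw m
  have hNz : ∀ (g : absoluteGaloisGroup K) (hg : g ∈ H), g ∈ N → z.1 ⟨g, hg⟩ = 0 :=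
    fun g hg hgN ↦ hWz g hg hgN
  set Ω : Subgroup (absoluteGaloisGroup K) := H ⊔ N with hΩ
  have hΩopen : IsOpen (Ω : Set (absoluteGaloisGroup K)) := Subgroup.isOpen_mono le_sup_right hNopen
  have hmemΩ : ∀ σ : absoluteGaloisGroup K, σ ∈ Ω ↔ ∃ h ∈ H, ∃ w ∈ N, h * w = σ := by
    intro σ
    rw [← SetLike.mem_coe, hΩ, Subgroup.mul_normal H N, Set.mem_mul]
    simp only [SetLike.mem_coe]
  have hzmul : ∀ x x' : H, z.1 (x * x') = z.1 x + (x : absoluteGaloisGroup K) • z.1 x' :=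
    fun x x' ↦ z.2 x x'
  have hwd : ∀ (h h' w w' : absoluteGaloisGroup K) (hh : h ∈ H) (hh' : h' ∈ H),
      w ∈ N → w' ∈ N → h * w = h' * w' → z.1 ⟨h, hh⟩ = z.1 ⟨h', hh'⟩ := by
    intro h h' w w' hh hh' hw hw' heq
    have hq : h⁻¹ * h' = w * w'⁻¹ := by
      calc h⁻¹ * h' = h⁻¹ * (h' * w') * w'⁻¹ := by group
        _ = h⁻¹ * (h * w) * w'⁻¹ := by rw [heq]
        _ = w * w'⁻¹ := by group
    have hqN : h⁻¹ * h' ∈ N := by rw [hq]; exact N.mul_mem hw (N.inv_mem hw')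
    have hqH : h⁻¹ * h' ∈ H := H.mul_mem (H.inv_mem hh) hh'
    have e : (⟨h', hh'⟩ : H) = ⟨h, hh⟩ * ⟨h⁻¹ * h', hqH⟩ :=
      Subtype.ext (by rw [Subgroup.coe_mul]; exact (mul_inv_cancel_left h h').symm)
    rw [e, hzmul, hNz _ hqH hqN, smul_zero, add_zero]
  have hrepex : ∀ σ : Ω, ∃ h : absoluteGaloisGroup K, h ∈ H ∧ ∃ w ∈ N, h * w = σ := fun σ ↦ by
    obtain ⟨h, hh, w, hw, e⟩ := (hmemΩ σ).mp σ.2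
    exact ⟨h, hh, w, hw, e⟩
  choose rep hrepH wrep hwrepN hrepeq using hrepex
  let f : Ω → M := fun σ ↦ z.1 ⟨rep σ, hrepH σ⟩
  have hfval : ∀ (σ : Ω) (h w : absoluteGaloisGroup K) (hh : h ∈ H), w ∈ N →
      h * w = (σ : absoluteGaloisGroup K) → f σ = z.1 ⟨h, hh⟩ := by
    intro σ h w hh hw e
    exact hwd (rep σ) h (wrep σ) w (hrepH σ) hh (hwrepN σ) hw ((hrepeq σ).trans e.symm)
  have hfloc : IsLocallyConstant f := by
    rw [IsLocallyConstant.iff_exists_open]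
    intro σ₀
    refine ⟨{σ : Ω | ((σ₀ : absoluteGaloisGroup K))⁻¹ * (σ : absoluteGaloisGroup K) ∈ N}, ?_, ?_, ?_⟩
    · exact hNopen.preimage ((continuous_const.mul continuous_subtype_val))
    · change ((σ₀ : absoluteGaloisGroup K))⁻¹ * (σ₀ : absoluteGaloisGroup K) ∈ N
      rw [inv_mul_cancel]; exact N.one_mem
    · intro σ hσ
      refine hfval σ (rep σ₀) (wrep σ₀ * (((σ₀ : absoluteGaloisGroup K))⁻¹ * σ)) (hrepH σ₀)
        (N.mul_mem (hwrepN σ₀) hσ) ?_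
      rw [← mul_assoc, hrepeq σ₀, mul_inv_cancel_left]
  have hfmul : ∀ σ τ : Ω, f (σ * τ) = f σ + (σ : absoluteGaloisGroup K) • f τ := by
    intro σ τ
    have hconj : (rep τ)⁻¹ * wrep σ * rep τ ∈ N := by
      have := Subgroup.Normal.conj_mem inferInstance (wrep σ) (hwrepN σ) (rep τ)⁻¹
      rwa [inv_inv] at this
    have e : rep σ * rep τ * ((rep τ)⁻¹ * wrep σ * rep τ * wrep τ) =
        ((σ * τ : Ω) : absoluteGaloisGroup K) := by
      rw [Subgroup.coe_mul, ← hrepeq σ, ← hrepeq τ]; group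
    rw [hfval (σ * τ) (rep σ * rep τ) _ (H.mul_mem (hrepH σ) (hrepH τ)) (N.mul_mem hconj (hwrepN τ)) e]
    have e2 : (⟨rep σ * rep τ, H.mul_mem (hrepH σ) (hrepH τ)⟩ : H) =
        ⟨rep σ, hrepH σ⟩ * ⟨rep τ, hrepH τ⟩ := Subtype.ext rfl
    rw [e2, hzmul]
    change z.1 ⟨rep σ, hrepH σ⟩ + rep σ • z.1 ⟨rep τ, hrepH τ⟩ =
      z.1 ⟨rep σ, hrepH σ⟩ + (σ : absoluteGaloisGroup K) • z.1 ⟨rep τ, hrepH τ⟩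
    congr 1
    conv_rhs => rw [← hrepeq σ, mul_smul, hNfix (wrep σ) (hwrepN σ)]
  let zΩ : contOneCocycles (discreteTopRep Ω M) :=
    ⟨⟨f, hfloc.continuous⟩, fun σ τ ↦ hfmul σ τ⟩
  refine ⟨Ω, hΩopen, le_sup_left, oneCocycleClass _ zΩ, ?_⟩
  have hres : resOfLe M (le_sup_left : H ≤ Ω) (oneCocycleClass _ zΩ) = oneCocycleClass _
      (contOneCocycles.pullback (subgroupInclusion (le_sup_left : H ≤ Ω))
        (resHomOfEquivariant (subgroupInclusion (le_sup_left : H ≤ Ω)) (AddMonoidHom.id M)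
          (fun _ _ ↦ rfl)) zΩ) :=
    map_oneCocycleClass _ _ _ zΩ
  rw [hres]
  congr 1
  apply Subtype.ext
  ext x
  rw [contOneCocycles.pullback_apply]
  change f (subgroupInclusion (le_sup_left : H ≤ Ω) x) = z.1 x
  have hx : (x : absoluteGaloisGroup K) * 1 =
      ((subgroupInclusion (le_sup_left : H ≤ Ω) x : Ω) : absoluteGaloisGroup K) := by
    rw [mul_one]; rfl
  rw [hfval _ (x : absoluteGaloisGroup K) 1 x.2 N.one_mem hx]

end Extension

/-! ### §3 The local lemma (H): unramified ⟹ locally trivial after `E[p] ↪ E[p^∞]`, at a good `v ∤ p`,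
for every subgroup `H ⊇ I_v` (e.g. `H = Gal(K̄/K_∞)` for any `ℤ_p`-extension) -/

section Local

variable {K : Type} [Field K] [NumberField K] (E : WeierstrassCurve K) [E.IsElliptic]
  (p : ℕ) [Fact p.Prime]

omit [E.IsElliptic] [Fact p.Prime] in
/-- The unramified condition at the chosen place above `v` for `H ⊇ I_v = I_{𝔓₀}` is the vanishing of
the restriction to `I_{𝔓₀}` (the two inertia groups coincide, `inertia_adicCompletionPrime_eq_map_absInertia`;
both sides are read on cocycles). [cite: GreenbergVatsal2000, §2 p. 17] -/
theorem resOfLe_inertia_eq_zero_of_mem_unramifiedKer {v : HeightOneSpectrum (𝓞 K)}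
    {H : Subgroup (absoluteGaloisGroup K)}
    (hIH : (adicCompletionPrime K v).inertia (absoluteGaloisGroup K) ≤ H)
    {y : Literature.NumberTheory.EllipticCurves.subgroupH1 H (E.geomTorsion (p : ℤ))}
    (hy : y ∈ GreenbergVatsal2000.unramifiedKer H (E.geomTorsion (p : ℤ)) v) :
    resOfLe (↥(E.geomTorsion (p : ℤ))) hIH y = 0 := by
  obtain ⟨φ, rfl⟩ := oneCocycleClass_surjective _ y
  rw [GreenbergVatsal2000.unramifiedKer, AddMonoidHom.mem_ker,
    CocycleCriteria.resH1Hom_oneCocycleClass_eq_zero_iff] at hy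
  obtain ⟨n, hn⟩ := hy
  rw [CocycleCriteria.resOfLe_oneCocycleClass_eq_zero_iff]
  refine ⟨n, fun x ↦ ?_⟩
  have hxI : (x : absoluteGaloisGroup K) ∈ inertia v := by
    show (x : absoluteGaloisGroup K) ∈
      (absInertia (v.adicCompletion K)).map (absGaloisRestrict K (v.adicCompletion K)).toMonoidHom
    rw [← inertia_adicCompletionPrime_eq_map_absInertia]
    exact x.2
  have hxD : (x : absoluteGaloisGroup K) ∈ decomp v := inertia_le_decomp v hxI
  have hxH : (x : absoluteGaloisGroup K) ∈ H := hIH x.2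
  let x' : inertiaIn H v := ⟨⟨(x : absoluteGaloisGroup K), hxD⟩,
    (mem_inertiaIn_iff H v _).2 ⟨hxH, hxI⟩⟩
  have key := hn x'
  rw [AddMonoidHom.id_apply] at key
  have e : (inertiaInToH H v x' : H) = Subgroup.inclusion hIH x := Subtype.ext rfl
  rw [e] at key
  exact key

/-- **The local lemma (H).** Let `E/K` be an elliptic curve over a number field, `p` a prime,
`v ∤ p` a finite place of GOOD reduction, and `H ≤ Γ_K` ANY subgroup containing the inertia group
`I_v` of the chosen prime above `v` (e.g. `H = Gal(K̄/K_∞)` for a `ℤ_p`-extension — completely split or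
finitely decomposed at `v` alike). If `y ∈ H¹(H, E[p])` is UNRAMIFIED at the chosen place above `v`,
then its image `ι y ∈ H¹(H, E[p^∞])` is LOCALLY TRIVIAL there (`awayKer`): `y` extends to an open
`Ω ⊇ H` (§2), the extension restricted to `Ω ⊓ D_v` and pushed to `E[p^∞]` dies on `I_v`, hence is `0`
(§1), and so is its further restriction to `H ⊓ D_v`. ("`ℋ^ur_w(E[p^∞]) = 0` at good `w ∤ p` over
`K_∞`"; Greenberg–Vatsal p. 17.) [cite: GreenbergVatsal2000, §2 p. 17] [cite: GreenbergLNM1716, §3 Lemma 3.3 (p. 87)]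
[cite: Castella2018, §2.2 ("`ℋ^ur_v` vanishes")] -/
theorem torsionToPrimaryH1Sub_mem_awayKer_of_mem_unramifiedKer {v : HeightOneSpectrum (𝓞 K)}
    (hpv : (p : 𝓞 K) ∉ v.asIdeal) (hv : E.HasGoodReductionAt v)
    {H : Subgroup (absoluteGaloisGroup K)}
    (hIH : (adicCompletionPrime K v).inertia (absoluteGaloisGroup K) ≤ H)
    {y : Literature.NumberTheory.EllipticCurves.subgroupH1 H (E.geomTorsion (p : ℤ))}
    (hy : y ∈ GreenbergVatsal2000.unramifiedKer H (E.geomTorsion (p : ℤ)) v) :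
    E.torsionToPrimaryH1Sub p H y ∈ awayKer H (E.geomPrimaryTorsion p) v := by
  haveI : Finite (E.geomTorsion (p : ℤ)) :=
    finite_torsionPoints_holds E (AlgebraicClosure K) (by exact_mod_cast (Fact.out : p.Prime).ne_zero)
  have hcont : ∀ m : E.geomTorsion (p : ℤ), Continuous fun g : absoluteGaloisGroup K ↦ g • m :=
    fun m ↦ continuous_of_injective_comp (G := absoluteGaloisGroup K) Subtype.val_injective
      (continuous_smul_geomPoints E (m : E.geomPoints))
  obtain ⟨Ω, hΩ, hle, z, hz⟩ := exists_isOpen_resOfLe_eq hcont H y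
  set I := (adicCompletionPrime K v).inertia (absoluteGaloisGroup K) with hIdef
  have hIΩ : I ≤ Ω := hIH.trans hle
  have hIΩD : I ≤ Ω ⊓ decomp v := le_inf hIΩ (inertia_adicCompletionPrime_le_decomp v)
  have compP : ∀ {H₁ H₂ H₃ : Subgroup (absoluteGaloisGroup K)} (h₁ : H₁ ≤ H₂) (h₂ : H₂ ≤ H₃)
      (X : E.subgroupH1 p H₃),
      resOfLe (E.geomPrimaryTorsion p) h₁ (resOfLe (E.geomPrimaryTorsion p) h₂ X) =
        resOfLe (E.geomPrimaryTorsion p) (h₁.trans h₂) X := fun h₁ h₂ X ↦ by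
    have e := DFunLike.congr_fun (E.resOfLe_comp_holds p h₁ h₂) X
    simpa only [AddMonoidHom.comp_apply] using e
  have compT : ∀ {H₁ H₂ H₃ : Subgroup (absoluteGaloisGroup K)} (h₁ : H₁ ≤ H₂) (h₂ : H₂ ≤ H₃)
      (X : Literature.NumberTheory.EllipticCurves.subgroupH1 H₃ (E.geomTorsion (p : ℤ))),
      resOfLe (↥(E.geomTorsion (p : ℤ))) h₁ (resOfLe (↥(E.geomTorsion (p : ℤ))) h₂ X) =
        resOfLe (↥(E.geomTorsion (p : ℤ))) (h₁.trans h₂) X := fun h₁ h₂ X ↦ by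
    have e := DFunLike.congr_fun
      (Literature.NumberTheory.EllipticCurves.resOfLe_comp_holds (M := ↥(E.geomTorsion (p : ℤ))) h₁ h₂) X
    simpa only [AddMonoidHom.comp_apply] using e
  set c : E.subgroupH1 p (Ω ⊓ decomp v) :=
    resOfLe (E.geomPrimaryTorsion p) (inf_le_left : Ω ⊓ decomp v ≤ Ω)
      (E.torsionToPrimaryH1Sub p Ω z) with hc
  have hcI : resOfLe (E.geomPrimaryTorsion p) hIΩD c = 0 := by
    rw [hc, compP, resOfLe_torsionToPrimaryH1Sub, ← compT hIH hle z, hz,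
      resOfLe_inertia_eq_zero_of_mem_unramifiedKer E p hIH hy, map_zero]
  have hc0 : c = 0 :=
    (injective_iff_map_eq_zero _).mp (resOfLe_inertia_injective_of_isOpen E p hpv hv hΩ hIΩ) c hcI
  have hHD : H ⊓ decomp v ≤ Ω ⊓ decomp v := inf_le_inf_right _ hle
  rw [awayKer, AddMonoidHom.mem_ker, ← hz, ← resOfLe_torsionToPrimaryH1Sub, compP,
    ← compP hHD (inf_le_left : Ω ⊓ decomp v ≤ Ω) (E.torsionToPrimaryH1Sub p Ω z), ← hc, hc0, map_zero]

/-- **(H) over a `ℤ_p`-extension**: for `H = Gal(K̄/K_∞)` (`I_v ≤ ker κ`, `ℤ_p`-extensions are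
unramified outside `p`) the hypothesis `hH` of
`UniversalToricDescentResidualSelmerComparison.finite_residualSelmer_of_finite_selmerAc_pTorsion` holds at
every good place `v ∤ p`. [cite: GreenbergVatsal2000, §2 p. 17] [cite: Washington1997, Prop. 13.2] -/
theorem torsionToPrimaryH1Sub_mem_awayKer_of_mem_unramifiedKer_kerSubgroup (κ : ZpExtension K p)
    {v : HeightOneSpectrum (𝓞 K)} (hpv : (p : 𝓞 K) ∉ v.asIdeal) (hv : E.HasGoodReductionAt v)
    {y : Literature.NumberTheory.EllipticCurves.subgroupH1 κ.kerSubgroup (E.geomTorsion (p : ℤ))}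
    (hy : y ∈ GreenbergVatsal2000.unramifiedKer κ.kerSubgroup (E.geomTorsion (p : ℤ)) v) :
    E.torsionToPrimaryH1Sub p κ.kerSubgroup y ∈ awayKer κ.kerSubgroup (E.geomPrimaryTorsion p) v :=
  torsionToPrimaryH1Sub_mem_awayKer_of_mem_unramifiedKer E p hpv hv
    (ZpExtension.inertia_le_kerSubgroup_holds K p κ hpv (adicCompletionPrime_mem_primesAbove K v)) hy

end Local

end Summit.BirchSwinnertonDyer.BirchSwinnertonDyer.Theorems.UniversalToricDescentResidualSelmerLocal

end
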